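/-
Copyright (c) 2026 the pub-hodgecm-mathlib formalisation cell (harness21).  Prover seat hodgecm-mathlib-LH7-p04 (g9), (G3) of the E3a (L2) carving line (pen LH3-p04 (g8)
2026-09-02 17:56:25Z; dealer LH2-plan (g1) 17:47:44Z (a)): the binder-free E3 head.
-/
import Literature.NumberTheory.Rogawski1990.ArchEPAssemblyGlue       -- ★ (G2) (LH3-p04 (g8)): `ballTransfer_fixed` (the (L2) glue at arbitrary Haar; brings ★ (G1) p852328, ★ (CP) p852332, ★ (BD), ★ (Sel) p852327, ★ (L2)-measures p852313, ★ (L3) ED. 2 p852308)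
import Literature.NumberTheory.Rogawski1990.ArchEPGeneratorAll      -- ★ EP-ALL p852294 (F0P3a-p08 (g26)): `epGeneratorAt_esymm3_quasiSplit` (the `hEP` discharger)
import HarnessLib

/-!
# EP assembly, the binder-free head: the stable surjection H-S4′ onto the quasi-split atlas `diag(½, 1, −½)` (§3 of the E3 assembly)

Topic `NumberTheory/Rogawski1990`; namespace `Literature.NumberTheory.Rogawski1990`.  THEOREMS ONLY (no definition, no instance, no notation, no named fact, no `sorry`); kernel lane
`--supports stmt-HodgeConjecture-24833`.  Cell `pub/hodgecm-mathlib` (D-0151), crux H413; HCML «GO 500» road N8-INNER ROAD B «EP road» (owner LH2-plan (g1)), brick E3 «EP ASSEMBLY =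
H-S4′» — the statement the leaf `F0_P3c_ArchInnerTransferPaydown` v10 consumes (`stub_N8one`'s pay line), binder order `(L α) [σ×4] (μ′ μ) [×4] (hα) (hherm) (_hanis) (hEP)`
pinned by the leaf pen 2026-09-02 17:47:44Z.  This file is a LEAF above ★ `ArchEPAssembly` ED. 2 (p852308, §2 `stableSurjG_quasiSplit_of_ballTransferFixed` with the provisional
binder `hBT`) and ★ (G2) `ArchEPAssemblyGlue` (`ballTransfer_fixed` = the `hBT` letter, proved) — a separate file because (G2) imports `ArchEPAssembly`.
* **`stableSurjG_quasiSplit`** — the head with the generic one-place generator binder `hEP` (= the TYPE of ★ `epGeneratorAt_esymm3_quasiSplit L`): ★ §2 ∘ ★ (G2), one line.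
* **`stableSurjG_quasiSplit_of_epAll`** — the same with `hEP` DISCHARGED by ★ EP-ALL `epGeneratorAt_esymm3_quasiSplit` (p852294): H-S4′ on the quasi-split atlas outright, its only
  hypotheses the frame guards `hα`, `hherm` (and the leaf's anisotropy guard, carried unused).
THE CHAIN (all ★): one-place EP generators (7) regular p852141 ∕ (8) wall p852272 ∕ (10) corner p852279+p852289 → EP-ALL p852294; E3b class partition p852221, E3-CORE p852223, (L1)
p852251, (BI) p852321 + (BD) dock, hβ p852280, hα p852276, hgen p852290, (s1) p852258, (s2) p852288, §2(7) p852249, (T1) p852310 + (CP) p852332, (IT) p852057∕p852102∕p852235,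
(L2) Ball p852268∕p852284, (Sel) p852327, (G1) p852328, (L2)-measures p852313, (G2) Glue; E3-SUM p852243∕p852267 with (c2) p852248; (L3) ED. 2 p852308.
HONEST LABEL: count-neutral; HC_CM is proved only modulo the 7 printed citations (2 remaining: hLiu418 = stmt-HodgeConjecture-24832, h413 = stmt-HodgeConjecture-24833) until
rung 0 closes; H-S4′ is hereby PAID in-house on ★ inputs — the leaf v10 «(Sh) PAID IN HOUSE» is the leaf pen's write (D128′).

## References
* [Rogawski1990] J. D. Rogawski, *Automorphic Representations of Unitary Groups in Three Variables*, Ann. of Math. Stud. 123 (1990), §4.1 (4.1.1) p. 39; §14.2 (14.2.1) pp. 232–233.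
* [Shelstad1979] D. Shelstad, *Characters and inner forms of a quasi-split group over ℝ*, Compositio Math. 39 (1979), §4 p. 24, Lemma 4.2 p. 23, Thm. 4.1 p. 21.
* [Bouaziz1994IntegralesOrbitales] A. Bouaziz, *Intégrales orbitales sur les algèbres de Lie réductives*, Invent. Math. 115 (1994), §6.2 p. 591.
-/

set_option autoImplicit false

noncomputable section

open MeasureTheory NumberField NumberField.InfinitePlace Complex Set Function Metric
open Literature.NumberTheory.Automorphic Literature.NumberTheory.Automorphic.UnitaryGroup Literature.NumberTheory.Automorphic.ArchCartan
open scoped Classical MatrixGroups Matrix ContDiff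

namespace Literature.NumberTheory.Rogawski1990

section Head

variable (L : Type) [Field L] [NumberField L] [IsCMField L] (α : Fin 3 → L)
  [MeasurableSpace ↥(arch (↥(maximalRealSubfield L)) L (IsCMField.complexConj L) 3 (Matrix.diagonal α))]
  [BorelSpace ↥(arch (↥(maximalRealSubfield L)) L (IsCMField.complexConj L) 3 (Matrix.diagonal α))]
  [MeasurableSpace ↥(arch (↥(maximalRealSubfield L)) L (IsCMField.complexConj L) 3 (Matrix.diagonal ![(2 : L)⁻¹, 1, -(2 : L)⁻¹]))]
  [BorelSpace ↥(arch (↥(maximalRealSubfield L)) L (IsCMField.complexConj L) 3 (Matrix.diagonal ![(2 : L)⁻¹, 1, -(2 : L)⁻¹]))]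
  (μ' : Measure ↥(arch (↥(maximalRealSubfield L)) L (IsCMField.complexConj L) 3 (Matrix.diagonal α)))
  (μ : Measure ↥(arch (↥(maximalRealSubfield L)) L (IsCMField.complexConj L) 3 (Matrix.diagonal ![(2 : L)⁻¹, 1, -(2 : L)⁻¹])))
  [μ'.IsHaarMeasure] [μ'.IsMulRightInvariant] [μ.IsHaarMeasure] [μ.IsMulRightInvariant]

/-- **E3 HEAD, BINDER-FREE: H-S4′ ON THE QUASI-SPLIT ATLAS `diag(½, 1, −½)` (§3 of the E3 assembly; (G3) of the (L2) carving line).**  At a nondegenerate real diagonal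
frame `α` (anisotropy carried as the leaf's guard, unused), for free right-invariant Haar measures `μ′` on `U(diag α)_∞` and `μ` on `U(diag β₀)_∞`: GIVEN the one-place
Euler–Poincaré generators `hEP` at every elliptic class of `U(β₀)_w` for every complex place `w`, every Borel structure and every right-invariant Haar measure there (E1's head;
discharged by the bare name ★ EP-ALL `epGeneratorAt_esymm3_quasiSplit L`, p852294 — see `stableSurjG_quasiSplit_of_epAll`), **for every `a′ ∈ C_c^∞(U(diag α)_∞)` there is
`f ∈ C_c^∞(U(diag β₀)_∞)` with `stableSumG (orbFamGExt L β₀ μ f) S c = stableSumG (fun S′ c′ => (∏_{w ∈ D} 3⁻¹) · orbFamGExt L α μ′ a′ S′ c′) S c` on every `RegG S`** (`D` the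
`α`-definite places) — ★ ED. 2 `stableSurjG_quasiSplit_of_ballTransferFixed` with its provisional binder `hBT` DISCHARGED by ★ (G2) `ballTransfer_fixed` (the (L2) glue: ★ (G1)
combinator p852328 over ★ (CP) `exists_coupling` p852332, ★ (BD) readings dock, ★ (Sel) `exists_ballSelection_esymm3` p852327, ★ (L2)-measures p852313).  The TYPE is ★ §2's
with `hBT` deleted, binder order `(L α) [σ×4] (μ′ μ) [×4] (hα) (hherm) (_hanis) (hEP)` as pinned by the leaf pen LH2-plan (g1) 2026-09-02 17:47:44Z.
[cite: Rogawski1990, §14.2 (14.2.1) p. 232; §4.1 (4.1.1) p. 39] [cite: Shelstad1979, §4 p. 24, Lemma 4.2 p. 23] [cite: Bouaziz1994IntegralesOrbitales, §6.2 p. 591] -/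
theorem stableSurjG_quasiSplit (hα : ∀ i, α i ≠ 0) (hherm : ∀ i, (IsCMField.complexConj L (α i) : L) = α i)
    (_hanis : ∀ x : Fin 3 → L, hermForm (cmConjRingHom L) (Matrix.diagonal α) x x = 0 → x = 0)
    (hEP : ∀ (w : {w : InfinitePlace L // IsComplex w})
      [MeasurableSpace ↥(archLocal L 3 (Matrix.diagonal ![(2 : L)⁻¹, 1, -(2 : L)⁻¹]) w)] [BorelSpace ↥(archLocal L 3 (Matrix.diagonal ![(2 : L)⁻¹, 1, -(2 : L)⁻¹]) w)]
      (νw : Measure ↥(archLocal L 3 (Matrix.diagonal ![(2 : L)⁻¹, 1, -(2 : L)⁻¹]) w)) [νw.IsHaarMeasure] [νw.IsMulRightInvariant]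
      (l : Fin 3 → ℂ), (∀ i, ‖l i‖ = 1) → EPGeneratorAt L ![(2 : L)⁻¹, 1, -(2 : L)⁻¹] w νw (esymm3 l)) :
    ∀ a' : ↥(arch (↥(maximalRealSubfield L)) L (IsCMField.complexConj L) 3 (Matrix.diagonal α)) → ℂ, ArchSmooth L 3 (Matrix.diagonal α) a' →
      ∃ f : ↥(arch (↥(maximalRealSubfield L)) L (IsCMField.complexConj L) 3 (Matrix.diagonal ![(2 : L)⁻¹, 1, -(2 : L)⁻¹])) → ℂ,
        ArchSmooth L 3 (Matrix.diagonal ![(2 : L)⁻¹, 1, -(2 : L)⁻¹]) f ∧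
          ∀ (S : Finset {w : InfinitePlace L // IsComplex w}) (c : {w : InfinitePlace L // IsComplex w} → Fin 3 → ℝ), c ∈ RegG S →
            stableSumG (orbFamGExt L ![(2 : L)⁻¹, 1, -(2 : L)⁻¹] μ f) S c =
              stableSumG (fun S' c' => (∏ _w ∈ Finset.univ.filter (fun w : {w : InfinitePlace L // IsComplex w} => ¬ IsIndefiniteAt (slotSign L α) w), (3 : ℂ)⁻¹) *
                orbFamGExt L α μ' a' S' c') S c :=
  stableSurjG_quasiSplit_of_ballTransferFixed L α μ' μ hα hherm _hanis hEP (ballTransfer_fixed L α μ' μ hα hherm)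

/-- **H-S4′ ON THE QUASI-SPLIT ATLAS, OUTRIGHT**: `stableSurjG_quasiSplit` with the generator binder `hEP` discharged by ★ EP-ALL `epGeneratorAt_esymm3_quasiSplit` (one-place
Euler–Poincaré generators at every elliptic class of `U(β₀)_w`: regular ★ (7), wall ★ (8), scalar corner ★ (10)).  Hypotheses: the frame guards only.
[cite: Rogawski1990, §14.2 (14.2.1) p. 232; §3.6 p. 28; §8.2 p. 122] [cite: Shelstad1979, Thm. 4.1 p. 21, §4 p. 24] [cite: Bouaziz1994IntegralesOrbitales, §6.2 p. 591] -/
theorem stableSurjG_quasiSplit_of_epAll (hα : ∀ i, α i ≠ 0) (hherm : ∀ i, (IsCMField.complexConj L (α i) : L) = α i)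
    (_hanis : ∀ x : Fin 3 → L, hermForm (cmConjRingHom L) (Matrix.diagonal α) x x = 0 → x = 0) :
    ∀ a' : ↥(arch (↥(maximalRealSubfield L)) L (IsCMField.complexConj L) 3 (Matrix.diagonal α)) → ℂ, ArchSmooth L 3 (Matrix.diagonal α) a' →
      ∃ f : ↥(arch (↥(maximalRealSubfield L)) L (IsCMField.complexConj L) 3 (Matrix.diagonal ![(2 : L)⁻¹, 1, -(2 : L)⁻¹])) → ℂ,
        ArchSmooth L 3 (Matrix.diagonal ![(2 : L)⁻¹, 1, -(2 : L)⁻¹]) f ∧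
          ∀ (S : Finset {w : InfinitePlace L // IsComplex w}) (c : {w : InfinitePlace L // IsComplex w} → Fin 3 → ℝ), c ∈ RegG S →
            stableSumG (orbFamGExt L ![(2 : L)⁻¹, 1, -(2 : L)⁻¹] μ f) S c =
              stableSumG (fun S' c' => (∏ _w ∈ Finset.univ.filter (fun w : {w : InfinitePlace L // IsComplex w} => ¬ IsIndefiniteAt (slotSign L α) w), (3 : ℂ)⁻¹) *
                orbFamGExt L α μ' a' S' c') S c :=
  stableSurjG_quasiSplit L α μ' μ hα hherm _hanis (epGeneratorAt_esymm3_quasiSplit L)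

end Head

end Literature.NumberTheory.Rogawski1990

end
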